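import Mathlib
import Literature.AlgebraicGeometry.Tropical.TorusCycles
import Summits.HodgeConjecture.HodgeConjecture.Theorems.TropicalWeilObstructionGenericWeilPeriod
import Summits.HodgeConjecture.HodgeConjecture.Theorems.TropicalWeilObstructionTropicalWeilVanishingPrymThreeData
import HarnessLib

/-!
# Route `TropicalWeilObstruction` (Kontsevich's tropical test — NEGATION SINK, exploration, no summit claim):
# the `n = 3` CALIBRATION FAMILY, part II — tropical Koike dominance: Weil-generic Prym periods; the Schoen calibration, typed

Negation-sink bookkeeping of the cell `pub-hodge-tropical` (seat tropical-1 gen 25; kernel companion of HOME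
`certificates/prymtorelli/` by seat tropical-2 gen 19, refereed PASS by this seat). The crux K1 (`TropicalWeilVanishing`,
stmt-HodgeConjecture-18478) is about the very general tropical Weil EIGHTFOLD (`n = 4`). Its `n = 3` analogue should FAIL,
because on the very general abelian sixfold of Weil type with `K = ℚ(i)`, `δ = 1`, the Weil classes are algebraic (Schoen
1988 via Pryms of cyclic quartic étale covers of genus-4 curves; Koike 2002: that Prym map is DOMINANT onto the
9-dimensional Shimura variety `H_6`, `3g' − 3 = 9 = dim H_6`; Patel–Zhang 2025 make Schoen's canonical-system cycle explicit).
On the data of part I (`…PrymThreeData`: the period family `prymPeriod ℓ = Σ_e ℓ_e • QZ e` of the ℤ/4-Prym of the metric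
`K_{3,3}`, symmetric, `weilJ 3`-commuting, positive definite for `ℓ > 0`) this file proves the tropical DOMINANCE half in
the tree's own vocabulary and TYPES the cycle half:

* `algebraicIndependent_linear` — invertible rational linear substitutions preserve algebraic independence over `ℚ`
  (general; automorphism `X_i ↦ Σ_j M_{ij} X_j` of `ℚ[X]`);
* `isWeilGeneric_prymPeriod_iff` — **`IsWeilGeneric 3 (prymPeriod ℓ) ↔ AlgebraicIndependent ℚ ℓ`**: the nine free
  coordinates of the period are `Mfreeᵀ ℓ` with `Mfree ∈ GL₉(ℚ)` (`Afree * Bfree = 1`, from part I's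
  `Mfree * Nfree = 4`); `prymPeriod_injective`; and `prymPeriod_coeffOf` / `existsUnique_prymPeriod_eq` — EVERY
  symmetric real `6 × 6` matrix commuting with `weilJ 3` is `prymPeriod ℓ` for exactly one `ℓ ∈ ℝ⁹`: **the tropical Prym
  period map of `(K_{3,3}, c)` is a linear isomorphism `ℝ⁹ → Sym_J(3)`** (`eq_zero_of_free_eq_zero`: a `J`-commuting
  symmetric matrix is determined by its nine free Weil coordinates, `dim Sym_J(3) = 9 = 3g' − 3`);
* `exists_weilGeneric_prymPeriod`, `genericWeilPeriod_three` — **Weil-generic positive definite `J`-commuting PRYM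
  periods exist** (edge lengths `ℓ > 0` algebraically independent): the hypothesis `IsWeilGeneric 3` of the `n = 3`
  analogue of K1 does NOT exclude tropical Schoen–Pryms, which fill the open cone `prymPeriod(ℝ₊⁹)` — the tropical mirror
  of Koike's dominance (at `n = 4` the count fails: `3g' − 3 = 12 < 16`, Prym-borne cycles sit at non-generic periods);
* `TropicalSchoenCalibrationThree` (`@[conjecture]`, OPEN, expected TRUE) — some Weil-generic Prym period carries an
  effective tropical `3`-cycle with `W ≠ 0` (the cell's named, unbuilt `n = 3` seed: the tropical Schoen cycle
  `AP_*(N⁻¹|K_{Γ'}|)`; curve-only cycles have class `∝ θ₃`, `W = 0`); and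
  `not_tropicalWeilVanishing_three_of_schoenCalibration` — it refutes the verbatim `n = 3` analogue of K1, as the
  classical picture demands.

HONEST STATUS. Calibration statements one dimension below the crux; decide NOTHING about K1 (`n = 4`, OPEN), K1_∂, K2 or
the Hodge conjecture. One `@[conjecture]` definition and five plain definitions (an index enumeration, two rational matrices, the
coefficient map), no named-fact hypothesis, no sorry.
References: [Zharkov2020TropicalWeil] I. Zharkov, arXiv:2002.02347, §2 (pp. 2–4); K. Koike, Canad. Math. Bull. 47 (2004),
arXiv:math/0211304, §2 Thm 2.1 / Cor 2.1; C. Schoen, Compositio Math. 65 (1988); D. Patel, Z. Zhang, arXiv:2506.13729,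
Thm 1.1 / 1.2, §5.
-/

set_option linter.dupNamespace false

noncomputable section

namespace Summit.HodgeConjecture.HodgeConjecture.Theorems.TropicalWeilVanishing

namespace PrymThree

open scoped BigOperators Matrix
open Matrix Literature.AlgebraicGeometry.Tropical

/-! ### The free Weil coordinates and Weil-genericity -/

/-- Linear changes of variables with rational coefficients preserve algebraic independence over `ℚ`: if `x : ι → ℝ` is
algebraically independent and `M N = 1` in `M_ι(ℚ)`, then `i ↦ Σ_j M_{ij} x_j` is algebraically independent (the
substitution `X_i ↦ Σ_j M_{ij} X_j` is an automorphism of `ℚ[X]` with inverse given by `N`). [folklore] -/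
theorem algebraicIndependent_linear {ι : Type*} [Fintype ι] [DecidableEq ι] {x : ι → ℝ}
    (hx : AlgebraicIndependent ℚ x) (M N : Matrix ι ι ℚ) (hMN : M * N = 1) :
    AlgebraicIndependent ℚ fun i => ∑ j, (M i j : ℝ) * x j := by
  classical
  let f : ι → MvPolynomial ι ℚ := fun i => ∑ j, MvPolynomial.C (M i j) * MvPolynomial.X j
  let g : ι → MvPolynomial ι ℚ := fun i => ∑ j, MvPolynomial.C (N i j) * MvPolynomial.X j
  have hgf : (MvPolynomial.aeval g).comp (MvPolynomial.aeval f) = AlgHom.id ℚ _ := by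
    refine MvPolynomial.algHom_ext fun i => ?_
    have key : ∀ k, (∑ j, MvPolynomial.C (σ := ι) (M i j) * MvPolynomial.C (N j k)) =
        MvPolynomial.C ((M * N) i k) := fun k => by
      simp only [Matrix.mul_apply, map_sum, map_mul]
    simp only [AlgHom.comp_apply, MvPolynomial.aeval_X, AlgHom.id_apply, f, g, map_sum, map_mul,
      MvPolynomial.aeval_C, MvPolynomial.algebraMap_eq]
    calc ∑ j, MvPolynomial.C (M i j) * ∑ k, MvPolynomial.C (N j k) * MvPolynomial.X k
        = ∑ j, ∑ k, MvPolynomial.C (M i j) * MvPolynomial.C (N j k) * MvPolynomial.X k := by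
          simp only [Finset.mul_sum, mul_assoc]
      _ = ∑ k, ∑ j, MvPolynomial.C (M i j) * MvPolynomial.C (N j k) * MvPolynomial.X k := Finset.sum_comm
      _ = ∑ k, (∑ j, MvPolynomial.C (M i j) * MvPolynomial.C (N j k)) * MvPolynomial.X k := by
          simp only [Finset.sum_mul]
      _ = ∑ k, MvPolynomial.C ((M * N) i k) * MvPolynomial.X k := by simp only [key]
      _ = MvPolynomial.X i := by
          rw [hMN]
          simp only [Matrix.one_apply, apply_ite MvPolynomial.C, map_one, map_zero, ite_mul, one_mul,
            zero_mul, Finset.sum_ite_eq, Finset.mem_univ, if_true]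
  have hinj : Function.Injective (MvPolynomial.aeval (R := ℚ) f) := by
    intro a b hab
    have := congrArg (MvPolynomial.aeval g) hab
    rwa [← AlgHom.comp_apply, ← AlgHom.comp_apply, hgf, AlgHom.id_apply, AlgHom.id_apply] at this
  have hf : AlgebraicIndependent ℚ f := by
    have h := (MvPolynomial.algebraicIndependent_X ι ℚ).map' hinj
    convert h using 1
    funext i
    simp [f]
  have key := hx.aeval_of_algebraicIndependent hf
  convert key using 1
  funext i
  simp [f, map_sum]

/-- Iterated rational linear combinations compose as the matrix product. [folklore] -/
theorem linComb_linComb {ι : Type*} [Fintype ι] (B A : Matrix ι ι ℚ) (v : ι → ℝ) (i : ι) :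
    ∑ j, (B i j : ℝ) * ∑ e, (A j e : ℝ) * v e = ∑ e, ((B * A) i e : ℝ) * v e := by
  simp only [Matrix.mul_apply, Rat.cast_sum, Rat.cast_mul, Finset.mul_sum, Finset.sum_mul]
  rw [Finset.sum_comm]
  exact Finset.sum_congr rfl fun e _ => Finset.sum_congr rfl fun j _ => by ring

/-- The identity matrix acts as the identity on coordinate families. [folklore] -/
theorem linComb_one {ι : Type*} [Fintype ι] [DecidableEq ι] (v : ι → ℝ) (i : ι) :
    ∑ e, ((1 : Matrix ι ι ℚ) i e : ℝ) * v e = v i := by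
  simp only [Matrix.one_apply]
  rw [Finset.sum_eq_single i (fun b _ hb => by rw [if_neg (Ne.symm hb)]; simp) (fun h => absurd (Finset.mem_univ i) h)]
  simp

/-- The `i`-th free Weil index (`weilFreeIndex 3`, column order of `Mfree`). [cite: Zharkov2020TropicalWeil, §2 (pp. 2–4)] -/
def freeIdx (i : Fin 9) : weilFreeIndex 3 := ⟨(freeRow i, freeCol i), free_admissible i⟩

/-- `weilFreeIndex 3` is a finite type (local, computable instance for `decide`). [folklore] -/
local instance instFintypeWeilFreeIndexThree : Fintype (weilFreeIndex 3) := by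
  unfold weilFreeIndex; infer_instance

/-- `weilFreeIndex 3` has decidable equality (local instance for `decide`). [folklore] -/
local instance instDecidableEqWeilFreeIndexThree : DecidableEq (weilFreeIndex 3) := by
  unfold weilFreeIndex; infer_instance

/-- `freeIdx` is a bijection `Fin 9 → weilFreeIndex 3` (the nine free coordinates of a `J`-commuting symmetric `6 × 6`
matrix). [folklore] -/
theorem freeIdx_bijective : Function.Bijective freeIdx := by decide

/-- The enumeration `Fin 9 ≃ weilFreeIndex 3`. [folklore] -/
def freeEquiv : Fin 9 ≃ weilFreeIndex 3 := Equiv.ofBijective freeIdx freeIdx_bijective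

/-- `Mfreeᵀ` as a rational matrix: the free-coordinate map `ℓ ↦ (free coordinates of prymPeriod ℓ)`. [folklore] -/
def Afree : Matrix (Fin 9) (Fin 9) ℚ := fun i e => (Mfree e i : ℚ)

/-- `¼ Nfreeᵀ`: the inverse of `Afree`. [folklore] -/
def Bfree : Matrix (Fin 9) (Fin 9) ℚ := fun i e => (Nfree e i : ℚ) / 4

/-- `Afree * Bfree = 1` and `Bfree * Afree = 1` (from `Mfree * Nfree = Nfree * Mfree = 4`). [folklore] -/
theorem Afree_mul_Bfree : Afree * Bfree = 1 ∧ Bfree * Afree = 1 := by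
  obtain ⟨h1, h2⟩ := Mfree_mul_Nfree
  have e1 : ∀ i k : Fin 9, (∑ j, (Mfree i j : ℚ) * (Nfree j k : ℚ)) = if i = k then 4 else 0 := fun i k => by
    have h := congrFun (congrFun h1 i) k
    simp only [Matrix.mul_apply, Matrix.smul_apply, Matrix.one_apply, smul_eq_mul, mul_ite, mul_one,
      mul_zero] at h
    exact_mod_cast h
  have e2 : ∀ i k : Fin 9, (∑ j, (Nfree i j : ℚ) * (Mfree j k : ℚ)) = if i = k then 4 else 0 := fun i k => by
    have h := congrFun (congrFun h2 i) k
    simp only [Matrix.mul_apply, Matrix.smul_apply, Matrix.one_apply, smul_eq_mul, mul_ite, mul_one,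
      mul_zero] at h
    exact_mod_cast h
  constructor
  · ext i k
    simp only [Matrix.mul_apply, Afree, Bfree, Matrix.one_apply]
    have : ∑ j, (Mfree j i : ℚ) * ((Nfree k j : ℚ) / 4) = (∑ j, (Nfree k j : ℚ) * (Mfree j i : ℚ)) / 4 := by
      rw [Finset.sum_div]; exact Finset.sum_congr rfl fun j _ => by ring
    rw [this, e2 k i]
    by_cases hik : i = k
    · subst hik; simp
    · rw [if_neg (Ne.symm hik), if_neg hik]; simp
  · ext i k
    simp only [Matrix.mul_apply, Afree, Bfree, Matrix.one_apply]
    have : ∑ j, (Nfree j i : ℚ) / 4 * (Mfree k j : ℚ) = (∑ j, (Mfree k j : ℚ) * (Nfree j i : ℚ)) / 4 := by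
      rw [Finset.sum_div]; exact Finset.sum_congr rfl fun j _ => by ring
    rw [this, e1 k i]
    by_cases hik : i = k
    · subst hik; simp
    · rw [if_neg (Ne.symm hik), if_neg hik]; simp

/-- The free Weil coordinates of the Prym period are `Afree ℓ = Mfreeᵀ ℓ`. [folklore] -/
theorem prymPeriod_freeIdx (ℓ : Fin 9 → ℝ) (i : Fin 9) :
    prymPeriod ℓ (freeIdx i).1.1 (freeIdx i).1.2 = ∑ e, (Afree i e : ℝ) * ℓ e := by
  simp only [freeIdx, prymPeriod, QR, Afree, Rat.cast_intCast]
  exact Finset.sum_congr rfl fun e _ => by rw [QZ_free e i]; ring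

/-- **Weil-genericity of a Prym period = algebraic independence of the edge lengths**: the nine free coordinates of
`prymPeriod ℓ` are `Mfreeᵀ ℓ` with `Mfree ∈ GL₉(ℚ)` (`det Mfree = 1024`), and invertible rational linear substitutions
preserve transcendence degree. [cite: Zharkov2020TropicalWeil, §2 (pp. 2–4)] -/
theorem isWeilGeneric_prymPeriod_iff (ℓ : Fin 9 → ℝ) :
    IsWeilGeneric 3 (prymPeriod ℓ) ↔ AlgebraicIndependent ℚ ℓ := by
  unfold IsWeilGeneric
  have hcomp : (fun ab : weilFreeIndex 3 => prymPeriod ℓ ab.1.1 ab.1.2) ∘ freeEquiv =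
      fun i => ∑ e, (Afree i e : ℝ) * ℓ e := by
    funext i
    simp only [Function.comp_apply, freeEquiv, Equiv.ofBijective_apply, prymPeriod_freeIdx]
  rw [← algebraicIndependent_equiv freeEquiv, hcomp]
  constructor
  · intro h
    have h2 := algebraicIndependent_linear h Bfree Afree Afree_mul_Bfree.2
    convert h2 using 1
    funext i
    rw [linComb_linComb, Afree_mul_Bfree.2, linComb_one]
  · intro h
    exact algebraicIndependent_linear h Afree Bfree Afree_mul_Bfree.1

/-- The Prym period map `ℓ ↦ prymPeriod ℓ` is injective (its free-coordinate part is `Mfreeᵀ ∈ GL₉(ℚ)`). [folklore] -/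
theorem prymPeriod_injective : Function.Injective prymPeriod := by
  intro ℓ ℓ' h
  have hfree : ∀ i, ∑ e, (Afree i e : ℝ) * ℓ e = ∑ e, (Afree i e : ℝ) * ℓ' e := fun i => by
    rw [← prymPeriod_freeIdx, ← prymPeriod_freeIdx, h]
  funext e
  have := congrArg (fun w : Fin 9 → ℝ => ∑ j, (Bfree e j : ℝ) * w j) (funext hfree)
  simp only [linComb_linComb, Afree_mul_Bfree.2, linComb_one] at this
  exact this

/-! ### Surjectivity onto `Sym_J(3)`: the period map is a linear isomorphism `ℝ⁹ → Sym_J(3)` -/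

/-- A symmetric real `6 × 6` matrix commuting with `J = weilJ 3` whose nine free Weil coordinates vanish is zero:
`Y = [[A, B], [-B, A]]` with `A` symmetric, `B` antisymmetric is determined by the upper triangle of `A` and the strict
upper triangle of `B` (`dim Sym_J(3) = 9`). [cite: Zharkov2020TropicalWeil, §2 (pp. 2–4)] -/
theorem eq_zero_of_free_eq_zero (Y : Matrix (Fin 6) (Fin 6) ℝ) (hYt : Yᵀ = Y)
    (hYJ : Y * (weilJ 3 : Matrix (Fin 6) (Fin 6) ℝ) = (weilJ 3 : Matrix (Fin 6) (Fin 6) ℝ) * Y)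
    (hfree : ∀ i : Fin 9, Y (freeRow i) (freeCol i) = 0) : Y = 0 := by
  have hs : ∀ a b : Fin 6, Y b a = Y a b := fun a b => by
    have h := congrFun (congrFun hYt a) b
    simpa only [Matrix.transpose_apply] using h
  have hJ : ∀ a b : Fin 6, (Y * (weilJ 3 : Matrix (Fin 6) (Fin 6) ℝ)) a b =
      ((weilJ 3 : Matrix (Fin 6) (Fin 6) ℝ) * Y) a b := fun a b => by rw [hYJ]
  obtain ⟨f0, f1, f2⟩ : Y 0 0 = 0 ∧ Y 0 1 = 0 ∧ Y 0 2 = 0 := ⟨hfree 0, hfree 1, hfree 2⟩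
  obtain ⟨f3, f4, f5⟩ : Y 1 1 = 0 ∧ Y 1 2 = 0 ∧ Y 2 2 = 0 := ⟨hfree 3, hfree 4, hfree 5⟩
  obtain ⟨f6, f7, f8⟩ : Y 0 4 = 0 ∧ Y 0 5 = 0 ∧ Y 1 5 = 0 := ⟨hfree 6, hfree 7, hfree 8⟩
  obtain ⟨s01, s02, s03⟩ : Y 1 0 = Y 0 1 ∧ Y 2 0 = Y 0 2 ∧ Y 3 0 = Y 0 3 := ⟨hs 0 1, hs 0 2, hs 0 3⟩
  obtain ⟨s04, s05, s12⟩ : Y 4 0 = Y 0 4 ∧ Y 5 0 = Y 0 5 ∧ Y 2 1 = Y 1 2 := ⟨hs 0 4, hs 0 5, hs 1 2⟩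
  obtain ⟨s13, s14, s15⟩ : Y 3 1 = Y 1 3 ∧ Y 4 1 = Y 1 4 ∧ Y 5 1 = Y 1 5 := ⟨hs 1 3, hs 1 4, hs 1 5⟩
  obtain ⟨s23, s24, s25⟩ : Y 3 2 = Y 2 3 ∧ Y 4 2 = Y 2 4 ∧ Y 5 2 = Y 2 5 := ⟨hs 2 3, hs 2 4, hs 2 5⟩
  obtain ⟨s34, s35, s45⟩ : Y 4 3 = Y 3 4 ∧ Y 5 3 = Y 3 5 ∧ Y 5 4 = Y 4 5 := ⟨hs 3 4, hs 3 5, hs 4 5⟩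
  have j00 := hJ 0 0
  have j01 := hJ 0 1
  have j02 := hJ 0 2
  have j03 := hJ 0 3
  have j04 := hJ 0 4
  have j05 := hJ 0 5
  have j10 := hJ 1 0
  have j11 := hJ 1 1
  have j12 := hJ 1 2
  have j13 := hJ 1 3
  have j14 := hJ 1 4
  have j15 := hJ 1 5
  have j20 := hJ 2 0
  have j21 := hJ 2 1
  have j22 := hJ 2 2
  have j23 := hJ 2 3
  have j24 := hJ 2 4
  have j25 := hJ 2 5
  simp [Matrix.mul_apply, Fin.sum_univ_succ, weilJ] at j00 j01 j02 j03 j04 j05 j10 j11 j12 j13 j14 j15 j20 j21 j22 j23 j24 j25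
  -- every entry is now a linear consequence
  ext a b
  rw [Matrix.zero_apply]
  fin_cases a <;> fin_cases b
  · exact (show Y 0 0 = 0 by linarith)
  · exact (show Y 0 1 = 0 by linarith)
  · exact (show Y 0 2 = 0 by linarith)
  · exact (show Y 0 3 = 0 by linarith)
  · exact (show Y 0 4 = 0 by linarith)
  · exact (show Y 0 5 = 0 by linarith)
  · exact (show Y 1 0 = 0 by linarith)
  · exact (show Y 1 1 = 0 by linarith)
  · exact (show Y 1 2 = 0 by linarith)
  · exact (show Y 1 3 = 0 by linarith)
  · exact (show Y 1 4 = 0 by linarith)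
  · exact (show Y 1 5 = 0 by linarith)
  · exact (show Y 2 0 = 0 by linarith)
  · exact (show Y 2 1 = 0 by linarith)
  · exact (show Y 2 2 = 0 by linarith)
  · exact (show Y 2 3 = 0 by linarith)
  · exact (show Y 2 4 = 0 by linarith)
  · exact (show Y 2 5 = 0 by linarith)
  · exact (show Y 3 0 = 0 by linarith)
  · exact (show Y 3 1 = 0 by linarith)
  · exact (show Y 3 2 = 0 by linarith)
  · exact (show Y 3 3 = 0 by linarith)
  · exact (show Y 3 4 = 0 by linarith)
  · exact (show Y 3 5 = 0 by linarith)
  · exact (show Y 4 0 = 0 by linarith)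
  · exact (show Y 4 1 = 0 by linarith)
  · exact (show Y 4 2 = 0 by linarith)
  · exact (show Y 4 3 = 0 by linarith)
  · exact (show Y 4 4 = 0 by linarith)
  · exact (show Y 4 5 = 0 by linarith)
  · exact (show Y 5 0 = 0 by linarith)
  · exact (show Y 5 1 = 0 by linarith)
  · exact (show Y 5 2 = 0 by linarith)
  · exact (show Y 5 3 = 0 by linarith)
  · exact (show Y 5 4 = 0 by linarith)
  · exact (show Y 5 5 = 0 by linarith)

/-- The edge lengths recovered from the free Weil coordinates of a matrix: `coeffOf Q = Bfree · (free coordinates of Q)`,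
`Bfree = (Mfreeᵀ)⁻¹`. [folklore] -/
def coeffOf (Q : Matrix (Fin 6) (Fin 6) ℝ) : Fin 9 → ℝ := fun e => ∑ i, (Bfree e i : ℝ) * Q (freeRow i) (freeCol i)

/-- **Surjectivity of the Prym period map onto `Sym_J(3)`**: every symmetric real `6 × 6` matrix commuting with
`J = weilJ 3` is a (unique, `prymPeriod_injective`) real combination of the nine Prym forms `QZ e` — with
`prymPeriod_injective` this is the kernel form of 'the tropical Prym period map of (K_{3,3}, c) is a LINEAR ISOMORPHISM
`ℝ⁹ → Sym_J(3)`' (HOME `certificates/prymtorelli`, THEOREM §3; tropical Koike dominance). [cite: Zharkov2020TropicalWeil, §2 (pp. 2–4)] -/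
theorem prymPeriod_coeffOf (Q : Matrix (Fin 6) (Fin 6) ℝ) (hQt : Qᵀ = Q)
    (hQJ : Q * (weilJ 3 : Matrix (Fin 6) (Fin 6) ℝ) = (weilJ 3 : Matrix (Fin 6) (Fin 6) ℝ) * Q) :
    prymPeriod (coeffOf Q) = Q := by
  have hY : prymPeriod (coeffOf Q) - Q = 0 := by
    refine eq_zero_of_free_eq_zero _ ?_ ?_ fun i => ?_
    · rw [Matrix.transpose_sub, prymPeriod_transpose, hQt]
    · rw [Matrix.sub_mul, Matrix.mul_sub, prymPeriod_mul_weilJ, hQJ]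
    · rw [Matrix.sub_apply, sub_eq_zero]
      have h := prymPeriod_freeIdx (coeffOf Q) i
      simp only [freeIdx] at h
      rw [h]
      simp only [coeffOf]
      rw [linComb_linComb, Afree_mul_Bfree.1, linComb_one]
  exact sub_eq_zero.mp hY

/-- **Tropical Koike dominance, isomorphism form**: `ℓ ↦ prymPeriod ℓ` is a bijection from `ℝ⁹` onto the symmetric real
`6 × 6` matrices commuting with `weilJ 3` (`Sym_J(3)`, `dim = 9 = 3g' − 3`): every tropical Weil sixfold period in the
tree's format is attained by exactly one (possibly non-positive) edge-length vector of the cover of `K_{3,3}`; the periods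
with `ℓ > 0` form the open Prym cone. [cite: Zharkov2020TropicalWeil, §2 (pp. 2–4)] -/
theorem existsUnique_prymPeriod_eq (Q : Matrix (Fin 6) (Fin 6) ℝ) (hQt : Qᵀ = Q)
    (hQJ : Q * (weilJ 3 : Matrix (Fin 6) (Fin 6) ℝ) = (weilJ 3 : Matrix (Fin 6) (Fin 6) ℝ) * Q) :
    ∃! ℓ : Fin 9 → ℝ, prymPeriod ℓ = Q :=
  ⟨coeffOf Q, prymPeriod_coeffOf Q hQt hQJ, fun _ hℓ => prymPeriod_injective (hℓ.trans (prymPeriod_coeffOf Q hQt hQJ).symm)⟩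

/-! ### Weil-generic Prym periods exist (tropical Koike dominance, existential form) -/

/-- There are positive algebraically independent edge lengths. [folklore] -/
theorem exists_pos_algebraicIndependent : ∃ ℓ : Fin 9 → ℝ, (∀ e, 0 < ℓ e) ∧ AlgebraicIndependent ℚ ℓ := by
  obtain ⟨y, hy, hsmall⟩ :=
    GenericWeilPeriod.exists_algebraicIndependent_real_small (Fin 9) (δ := 1 / 2) (by norm_num)
  refine ⟨fun e => ((1 : ℚ) : ℝ) * y e + ((1 : ℚ) : ℝ), fun e => ?_,
    GenericWeilPeriod.algebraicIndependent_affine hy (fun _ => 1) (fun _ => 1) fun _ => one_ne_zero⟩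
  have h1 : -(1 / 2 : ℝ) ≤ y e := by linarith [neg_abs_le (y e), hsmall e]
  push_cast
  linarith

/-- **Tropical Koike dominance (existential form).** There are edge lengths `ℓ > 0`, algebraically independent over `ℚ`,
and then the tropical Prym period `Q = prymPeriod ℓ` of the metric `K_{3,3}` is positive definite, commutes with
`J = weilJ 3`, and is WEIL-GENERIC (`IsWeilGeneric 3 Q`): the hypothesis of the `n = 3` analogue of the crux K1 does not
exclude tropical Schoen–Pryms (they fill the open cone `prymPeriod (ℝ₊⁹)`). Tropical mirror of Koike's dominance of the
Prym map `M_{13/4} → H_6` (`3g' − 3 = 9 = dim H_6`). [cite: Zharkov2020TropicalWeil, §2 (pp. 2–4)] -/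
theorem exists_weilGeneric_prymPeriod : ∃ ℓ : Fin 9 → ℝ, (∀ e, 0 < ℓ e) ∧ AlgebraicIndependent ℚ ℓ ∧
    (prymPeriod ℓ).PosDef ∧
    prymPeriod ℓ * (weilJ 3 : Matrix (Fin 6) (Fin 6) ℝ) = (weilJ 3 : Matrix (Fin 6) (Fin 6) ℝ) * prymPeriod ℓ ∧
    IsWeilGeneric 3 (prymPeriod ℓ) := by
  obtain ⟨ℓ, hpos, hai⟩ := exists_pos_algebraicIndependent
  exact ⟨ℓ, hpos, hai, prymPeriod_posDef hpos, prymPeriod_mul_weilJ ℓ, (isWeilGeneric_prymPeriod_iff ℓ).2 hai⟩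

/-- The `n = 3` analogue of the route's support item `GenericWeilPeriod` (stmt-18481, `n = 4`), with a Prym witness: a
positive definite real `6 × 6` matrix commuting with `weilJ 3` whose nine free entries are algebraically independent
over `ℚ`. [cite: Zharkov2020TropicalWeil, §2 (pp. 2–4)] -/
theorem genericWeilPeriod_three :
    ∃ Q : Matrix (Fin (2 * 3)) (Fin (2 * 3)) ℝ, Q.PosDef ∧ Q * weilJ 3 = weilJ 3 * Q ∧ IsWeilGeneric 3 Q := by
  obtain ⟨ℓ, -, -, hpd, hJ, hgen⟩ := exists_weilGeneric_prymPeriod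
  exact ⟨prymPeriod ℓ, hpd, hJ, hgen⟩

/-! ### The cycle half, typed: the tropical Schoen calibration at `n = 3` -/

/-- **K2-cal at `n = 3` — the TROPICAL SCHOEN CALIBRATION (OPEN; expected TRUE; the cell's named, unbuilt seed).**
Some tropical Schoen–Prym sixfold of the metric `K_{3,3}` with algebraically independent positive edge lengths — hence a
WEIL-GENERIC positive definite `J`-commuting period `prymPeriod ℓ` (`exists_weilGeneric_prymPeriod`) — carries an
effective tropical `3`-cycle `Z` (the tree's `TropicalTorusCycle (2*3) 3`) with Weil functional `W(Z) ≠ 0`. Classically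
(Schoen 1988; Koike 2002, Cor. 2.1; Patel–Zhang 2025, Thm 1.2) the Weil classes of the very general `ℚ(i)`-Weil sixfold with
`δ = 1` are algebraic BECAUSE it is such a Prym and Schoen's canonical-system cycle `AJ_*(N⁻¹|K_{C'}|)` carries them; the
expected tropical witness is the tropicalisation of that cycle (the Abel–Prym image of `N⁻¹(|K_{Γ'}|) ⊂ Sym⁶(Γ)`), which is
NOT built and not in print (the tropical canonical system is not pure-dimensional; L-sized). Curve-only (Pontryagin)
cycles cannot serve: their classes are multiples of `θ₃`, on which `W` vanishes. A proof settles the `n = 3` calibration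
of Kontsevich's tropical test in the affirmative (`not_tropicalWeilVanishing_three_of_schoenCalibration`); a disproof
would be a genuine anomaly of the tropical test one dimension below the crux. HONEST STATUS: open; a calibration
statement of a negation-sink cell; nothing here bears on the Hodge conjecture.
[cite: Zharkov2020TropicalWeil, §2 (pp. 2–4)] -/
@[conjecture] def TropicalSchoenCalibrationThree : Prop :=
  ∃ ℓ : Fin 9 → ℝ, (∀ e, 0 < ℓ e) ∧ AlgebraicIndependent ℚ ℓ ∧
    ∃ Z : TropicalTorusCycle (2 * 3) 3 (prymPeriod ℓ), weilFunctional Z ≠ 0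

/-- **The tropical Schoen calibration refutes the `n = 3` analogue of the crux K1** (`TropicalWeilVanishing` with
`4 ↦ 3` verbatim): a Weil-generic Prym period with a `W ≠ 0` effective `3`-cycle is a counterexample, since Prym periods
with positive algebraically independent edge lengths satisfy all three hypotheses (`prymPeriod_posDef`,
`prymPeriod_mul_weilJ`, `isWeilGeneric_prymPeriod_iff`). [cite: Zharkov2020TropicalWeil, §2 (pp. 2–4)] -/
theorem not_tropicalWeilVanishing_three_of_schoenCalibration (h : TropicalSchoenCalibrationThree) :
    ¬ (∀ Q : Matrix (Fin (2 * 3)) (Fin (2 * 3)) ℝ, Q.PosDef → Q * weilJ 3 = weilJ 3 * Q → IsWeilGeneric 3 Q →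
        ∀ Z : TropicalTorusCycle (2 * 3) 3 Q, weilFunctional Z = 0) := by
  intro hK
  obtain ⟨ℓ, hpos, hai, Z, hZ⟩ := h
  exact hZ (hK (prymPeriod ℓ) (prymPeriod_posDef hpos) (prymPeriod_mul_weilJ ℓ)
    ((isWeilGeneric_prymPeriod_iff ℓ).2 hai) Z)

end PrymThree

end Summit.HodgeConjecture.HodgeConjecture.Theorems.TropicalWeilVanishing

end
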